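import Mathlib
import HarnessLib
import Summits.HubbardSuperconductivity.HubbardSuperconductivity.Theorems.KLProgrammeC4aPPKernelModelWindowTransfer
import Summits.HubbardSuperconductivity.HubbardSuperconductivity.Theorems.KLProgrammeC4aPPKernelModelWindowJets

/-!
# Route `KLProgramme` — crux C4a, S3 brick (B4) «(B4)-UMK1», «(B3)-K MODEL WINDOW» part 6: the count-free WINDOW TAIL at nonzero transfer —
# `‖K_Ω − (1/β)·W₁‖ ≤ 4/ω_M` for `2|Ω| ≤ ω_M`, hence `S_pp(t)` per lattice momentum `= β(βL²)²K_Ω + O((βL²)²β/ω_M)`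

Cell `gate-hubbard-kl`, seat hubbard-kl-k3c3-p1 (g18; row «δμ-flow with klAngularMean constant piece»).  Companion of `…ModelWindowTransfer` (part 5: defs `ppTransferKernel` = `K_Ω`,
`ppTransferWindowSum` = `W_c`, exact identification of the vertex's `S_pp(t)`).  A pair excluded from the window has a line with `|ω| ≥ ω_M`; under `2|Ω| ≤ ω_M` its
partner has `|Ω − ω| ≥ |ω|/2`, so the pair is `≤ 2/ω²`, and the excluded pairs sum (over both lines, the second by the bosonic shift invariance `n ↦ t − n`) to
`≤ 4β/ω_M` by the `tanh` closed form of part 1.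
* `matsubaraFreq_eq_ppFreqZ`, `ppFreqZ_natCast/_neg_succ`, `sum_matsubaraIdx_int_eq_sum_Ico`, `ppFreq_le_abs_ppFreqZ_of_not_window`, `ppFreq_lt_of_lt`,
  `norm_uvSymbolFnXi_le_inv_abs` (`≤ 1/|ω|`), `norm_pair_le_of_edge` (`≤ 2/ω²`);
* **`norm_ppTransferKernel_sub_window_le`**: `2|ppBose β (t+1)| ≤ ppFreq β M ⟹ ‖K_Ω(e,u) − (1/β)·ppTransferWindowSum β Λ 1 M t e u‖ ≤ 4/ω_M` for ALL levels;
  `ppTransferWindowSum_eq_sq_mul` (`W_c = c²W₁`), `two_abs_ppBose_le_ppFreq` (integer criterion `4|t+1| ≤ 2M+1`), and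
  **`norm_ppTransferWindowSum_sub_kernel_le`**: `‖W_c − c²β·K_Ω‖ ≤ c²β·4/ω_M` — with part 5's `secondOrder_ppBubble_transfer_eq`, the vertex's pp bubble at every slice
  frequency is `β(βL²)²·K_Ω(e_K p⃗, e_K(S⃗−p⃗))` per lattice momentum up to a count-free `(βL²)²β·4/ω_M` (at `M ≥ klEngM₃ β U L` below every currency of (C));
* §12 the ph channel at EVERY transfer: `sum_sum_ite_ph_transfer_eq`, `ppFreqZ_add_eq_neg`, **`secondOrder_phBubble_transfer_eq`**: with `d = n_{p₀} − n_κ`,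
  `S_ph(d) = −Σ_{p⃗} ppTransferWindowSum β Λ (βL²) M (−d−1) (e_K p⃗) (−e_K(p⃗+q⃗−k⃗))` — the pp windowed sum at the NEGATED partner level (`Ψ_c(u,ω+D) = −Ψ_c(−u,(−D)−ω)`),
  so BOTH bubbles of the vertex, at EVERY slice frequency, are the one object `ppTransferWindowSum` = `β·K_Ω` up to the window tail.
Pure real/complex analysis on Literature objects; nothing asserts (C), any engine row, K3, the window or superconductivity.
References: BGM 2006 §2.1 (2.3)–(2.4) [cite: BenfattoGiulianiMastropietro2006]; Salmhofer 1999 §4.2.4 (4.63), §4.2.5 (4.70) [cite: Salmhofer1999].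
-/

noncomputable section

namespace Summit.HubbardSuperconductivity.HubbardSuperconductivity.Theorems.C4a

set_option linter.dupNamespace false -- summit = problem name (single-conjunct summit), D-0017

open Real Filter Set Finset Complex
open scoped Topology
open Literature.MathematicalPhysics.QuantumLattice Literature.Analysis.SpecialFunctions

/-! ## §11 NONZERO TRANSFER, the count-free WINDOW TAIL: `‖K_Ω − (1/β)·W₁‖ ≤ 4/ω_M` for `2|Ω| ≤ ω_M` -/

section TransferTail

open Literature.Probability.LatticeModels

/-- The lattice frequency is the `ℤ`-indexed one at the integer label. [folklore] -/
theorem matsubaraFreq_eq_ppFreqZ (β : ℝ) {M : ℕ} (i : MatsubaraIdx M) : matsubaraFreq β M i = ppFreqZ β (matsubaraInt M i) := by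
  unfold matsubaraFreq ppFreqZ; ring

/-- `ω_k = ppFreq β k` for natural labels, `ω_{−(k+1)} = −ppFreq β k`. [folklore] -/
theorem ppFreqZ_natCast (β : ℝ) (k : ℕ) : ppFreqZ β (k : ℤ) = ppFreq β k := by unfold ppFreqZ ppFreq; push_cast; ring

/-- `ω_{−(k+1)} = −ppFreq β k`. [folklore] -/
theorem ppFreqZ_neg_succ (β : ℝ) (k : ℕ) : ppFreqZ β (-((k : ℤ) + 1)) = -ppFreq β k := by unfold ppFreqZ ppFreq; push_cast; ring

/-- A sum over the window as a sum over the integer labels `[−M, M)`. [folklore] -/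
theorem sum_matsubaraIdx_int_eq_sum_Ico {M : ℕ} {E : Type*} [AddCommMonoid E] (F : ℤ → E) :
    ∑ i : MatsubaraIdx M, F (matsubaraInt M i) = ∑ n ∈ Finset.Ico (-(M : ℤ)) M, F n := by
  classical
  have himage : Finset.Ico (-(M : ℤ)) M = (Finset.univ : Finset (MatsubaraIdx M)).image (matsubaraInt M) := by
    ext n
    simp only [Finset.mem_Ico, Finset.mem_image, Finset.mem_univ, true_and]
    constructor
    · rintro ⟨h1, h2⟩
      refine ⟨⟨(n + M).toNat, by omega⟩, ?_⟩
      simp only [matsubaraInt]; omega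
    · rintro ⟨i, rfl⟩
      have := i.isLt
      simp only [matsubaraInt]; omega
  have hinj : Set.InjOn (matsubaraInt M) (Finset.univ : Finset (MatsubaraIdx M)) := by
    intro a _ b _ h; apply Fin.ext; unfold matsubaraInt at h; omega
  rw [himage, Finset.sum_image hinj]

/-- Outside the window the frequency is beyond the window edge: `n ∉ [−M, M) ⟹ ω_M ≤ |ωₙ|`. [folklore] -/
theorem ppFreq_le_abs_ppFreqZ_of_not_window {β : ℝ} (hβ : 0 < β) {M : ℕ} {n : ℤ} (h : ¬(-(M : ℤ) ≤ n ∧ n < M)) :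
    ppFreq β M ≤ |ppFreqZ β n| := by
  unfold ppFreq ppFreqZ
  rw [abs_div, abs_of_pos hβ, div_le_div_iff_of_pos_right hβ, abs_mul, abs_of_pos Real.pi_pos]
  refine mul_le_mul_of_nonneg_right ?_ Real.pi_pos.le
  rcases not_and_or.1 h with h1 | h1
  · have : (n : ℝ) ≤ -(M : ℝ) - 1 := by exact_mod_cast (show n ≤ -(M : ℤ) - 1 by omega)
    rw [le_abs]; right; linarith
  · have : (M : ℝ) ≤ (n : ℝ) := by exact_mod_cast (show (M : ℤ) ≤ n by omega)
    rw [le_abs]; left; linarith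

/-- Inside the window (natural labels): `k < M ⟹ ppFreq β k < ppFreq β M`. [folklore] -/
theorem ppFreq_lt_of_lt {β : ℝ} (hβ : 0 < β) {k M : ℕ} (h : k < M) : ppFreq β k < ppFreq β M := by
  unfold ppFreq
  rw [div_lt_div_iff_of_pos_right hβ]
  have : (k : ℝ) + 1 ≤ (M : ℝ) := by exact_mod_cast h
  nlinarith [Real.pi_pos]

/-- `‖Ψ̂(ω,x)‖ ≤ 1/|ω|` (`ω ≠ 0`). [cite: BenfattoGiulianiMastropietro2006, §2.1 (2.3)] -/
theorem norm_uvSymbolFnXi_le_inv_abs {Λ : ℝ} (hΛ : 0 < Λ) {ω : ℝ} (hω : ω ≠ 0) (x : ℝ) : ‖uvSymbolFnXi 1 Λ ω x‖ ≤ 1 / |ω| := by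
  have h : ‖uvSymbolFnXi 1 Λ ω x‖ ≤ 1 / max |ω| (Λ / 2) := by rw [← uvSymbolFn_eq_uvSymbolFnXi]; exact norm_uvSymbolFn_le hΛ zero_le_one _
  exact h.trans (one_div_le_one_div_of_le (abs_pos.2 hω) (le_max_left _ _))

/-- **One excluded pair term is `≤ 2/ωₙ²` when its loop frequency lies beyond the window edge** (`ω_M ≤ |ωₙ|`, `2|Ω| ≤ ω_M`).
[cite: BenfattoGiulianiMastropietro2006, §2.1 (2.3)] -/
theorem norm_pair_le_of_edge {β Λ : ℝ} (hβ : 0 < β) (hΛ : 0 < Λ) {M : ℕ} {Ω ω : ℝ} (hΩ : 2 * |Ω| ≤ ppFreq β M) (hω : ppFreq β M ≤ |ω|) (x y : ℝ) :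
    ‖uvSymbolFnXi 1 Λ ω x * uvSymbolFnXi 1 Λ (Ω - ω) y‖ ≤ 2 / ω ^ 2 := by
  have hωM := ppFreq_pos hβ M
  have hω0 : 0 < |ω| := hωM.trans_le hω
  have hω' : |ω| / 2 ≤ |Ω - ω| := by
    have := abs_sub_abs_le_abs_sub Ω ω
    have h2 : |ω| - |Ω| ≤ |Ω - ω| := by rw [abs_sub_comm]; linarith [abs_sub_abs_le_abs_sub ω Ω]
    linarith
  have hΩω0 : 0 < |Ω - ω| := by linarith
  rw [norm_mul]
  have h1 := norm_uvSymbolFnXi_le_inv_abs hΛ (abs_pos.1 hω0) x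
  have h2 := norm_uvSymbolFnXi_le_inv_abs hΛ (abs_pos.1 hΩω0) y
  have h3 : 1 / |Ω - ω| ≤ 2 / |ω| := by
    rw [div_le_div_iff₀ hΩω0 hω0]; linarith
  calc ‖uvSymbolFnXi 1 Λ ω x‖ * ‖uvSymbolFnXi 1 Λ (Ω - ω) y‖ ≤ (1 / |ω|) * (2 / |ω|) := mul_le_mul h1 (h2.trans h3) (norm_nonneg _) (by positivity)
    _ = 2 / ω ^ 2 := by rw [← sq_abs]; field_simp

/-- **THE WINDOW TAIL AT NONZERO TRANSFER IS COUNT-FREE SMALL**: for `2|Ω| ≤ ω_M` (`Ω = ppBose β (t+1)`; at `M ≥ klEngM₃ β U L` every physical transfer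
`|Ω| ≤ Λ_{n−1} + π/β` qualifies), `‖K_Ω(e,u) − (1/β)·W₁(t;e,u)‖ ≤ 4/ω_M`, `W₁ = ppTransferWindowSum β Λ 1 M t` the model's windowed pair sum at unit volume.
Excluded pairs have a line beyond the window edge, where `|Ψ̂Ψ̂′| ≤ 2/ω²` sums (over both lines, by the bosonic shift invariance) to `≤ 4β/ω_M`.
[cite: BenfattoGiulianiMastropietro2006, §2.1 (2.3)-(2.4)] -/
theorem norm_ppTransferKernel_sub_window_le {β Λ : ℝ} (hβ : 0 < β) (hΛ : 0 < Λ) {M : ℕ} {t : ℤ} (hΩ : 2 * |ppBose β (t + 1)| ≤ ppFreq β M) (e u : ℝ) :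
    ‖ppTransferKernel β Λ (t + 1) e u - ((1 / β : ℝ) : ℂ) * ppTransferWindowSum β Λ 1 M t e u‖ ≤ 4 / ppFreq β M := by
  classical
  have hωM := ppFreq_pos hβ M
  set Ω := ppBose β (t + 1) with hΩdef
  set a : ℤ → ℂ := fun n => uvSymbolFnXi 1 Λ (ppFreqZ β n) e * uvSymbolFnXi 1 Λ (Ω - ppFreqZ β n) u with ha
  have hsum : Summable a := summable_ppTransferKernel hβ hΛ (t + 1) e u
  -- the window indicator
  set inW : ℤ → Prop := fun n => -(M : ℤ) ≤ n ∧ n < M with hinW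
  -- (1) the windowed sum as a `ℤ`-series with indicator
  have hW : ppTransferWindowSum β Λ 1 M t e u = ∑' n : ℤ, if inW n ∧ inW (t - n) then a n else 0 := by
    have hfin : ∀ n ∉ Finset.Ico (-(M : ℤ)) M, (if inW n ∧ inW (t - n) then a n else 0) = 0 := by
      intro n hn
      rw [if_neg]
      rintro ⟨h1, _⟩
      exact hn (Finset.mem_Ico.2 h1)
    rw [tsum_eq_sum hfin, ← sum_matsubaraIdx_int_eq_sum_Ico]
    unfold ppTransferWindowSum
    refine Finset.sum_congr rfl fun i _ => ?_
    have hi : -(M : ℤ) ≤ matsubaraInt M i ∧ matsubaraInt M i < M := by have := i.isLt; simp only [matsubaraInt]; omega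
    simp only [hinW, hi, true_and, ha, uvSymbolFn_eq_uvSymbolFnXi, matsubaraFreq_eq_ppFreqZ, hΩdef]
  -- (2) the difference as the series of the excluded terms
  set b : ℤ → ℂ := fun n => if inW n ∧ inW (t - n) then 0 else a n with hb
  have hab : ∀ n, a n - (if inW n ∧ inW (t - n) then a n else 0) = b n := fun n => by
    by_cases h : inW n ∧ inW (t - n) <;> simp [hb, h]
  have hbsum : Summable b := Summable.of_norm_bounded hsum.norm fun n => by
    by_cases h : inW n ∧ inW (t - n) <;> simp [hb, h]
  have hind : Summable fun n : ℤ => if inW n ∧ inW (t - n) then a n else 0 := Summable.of_norm_bounded hsum.norm fun n => by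
    by_cases h : inW n ∧ inW (t - n) <;> simp [h]
  have hdiff : ppTransferKernel β Λ (t + 1) e u - ((1 / β : ℝ) : ℂ) * ppTransferWindowSum β Λ 1 M t e u = ((1 / β : ℝ) : ℂ) * ∑' n : ℤ, b n := by
    unfold ppTransferKernel
    rw [hW, ← mul_sub, ← hsum.tsum_sub hind]
    simp_rw [hab]
  -- (3) the majorant of the excluded terms
  set g₁ : ℤ → ℝ := fun n => if inW n then 0 else 2 / ppFreqZ β n ^ 2 with hg₁
  set g : ℤ → ℝ := fun n => g₁ n + g₁ (t - n) with hg
  have hshift : ∀ n : ℤ, Ω - ppFreqZ β n = ppFreqZ β (t - n) := fun n => by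
    rw [hΩdef, ppBose_sub_ppFreqZ]; congr 1; ring
  have hbg : ∀ n, ‖b n‖ ≤ g n := by
    intro n
    have hg₁0 : ∀ k, 0 ≤ g₁ k := fun k => by simp only [hg₁]; split_ifs <;> positivity
    by_cases h : inW n ∧ inW (t - n)
    · simp only [hb, h, and_self, if_true, norm_zero, hg]; exact add_nonneg (hg₁0 _) (hg₁0 _)
    rw [hb]; simp only [h, if_false]
    rcases not_and_or.1 h with h1 | h1
    · have hedge := ppFreq_le_abs_ppFreqZ_of_not_window hβ h1
      have := norm_pair_le_of_edge hβ hΛ hΩ hedge e u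
      calc ‖a n‖ ≤ 2 / ppFreqZ β n ^ 2 := this
        _ = g₁ n := by simp only [hg₁, h1, if_false]
        _ ≤ g n := by simp only [hg]; linarith [hg₁0 (t - n)]
    · have hedge := ppFreq_le_abs_ppFreqZ_of_not_window hβ h1
      rw [← hshift n] at hedge
      -- swap the roles of the two lines: `ω = Ω − ω'`
      have hsym : a n = uvSymbolFnXi 1 Λ (Ω - ppFreqZ β n) u * uvSymbolFnXi 1 Λ (Ω - (Ω - ppFreqZ β n)) e := by
        rw [ha, sub_sub_cancel, mul_comm]
      have := norm_pair_le_of_edge hβ hΛ hΩ hedge u e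
      calc ‖a n‖ = ‖uvSymbolFnXi 1 Λ (Ω - ppFreqZ β n) u * uvSymbolFnXi 1 Λ (Ω - (Ω - ppFreqZ β n)) e‖ := by rw [hsym]
        _ ≤ 2 / (Ω - ppFreqZ β n) ^ 2 := this
        _ = g₁ (t - n) := by simp only [hg₁, h1, if_false, hshift n]
        _ ≤ g n := by simp only [hg]; linarith [hg₁0 n]
  -- (4) the majorant's sum: `Σ g₁ ≤ 2β/ω_M`, `Σ g = 2Σ g₁`
  have hg₁bd : ∀ n, |g₁ n| ≤ 2 * (1 / (ppFreqZ β n ^ 2 + 0 ^ 2)) := fun n => by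
    have hω := ppFreqZ_ne_zero hβ n
    simp only [hg₁]; split_ifs
    · rw [abs_zero]; positivity
    · rw [abs_of_pos (by positivity), zero_pow two_ne_zero, add_zero, mul_one_div]
  have hg₁sum : Summable g₁ := Summable.of_norm_bounded ((summable_one_div_ppFreqZ_sq_add_sq hβ 0).mul_left 2) fun n => by
    rw [Real.norm_eq_abs]; exact hg₁bd n
  have hg₁shift : Summable fun n : ℤ => g₁ (t - n) := by
    have : (fun n : ℤ => g₁ (t - n)) = g₁ ∘ (Equiv.subLeft t) := by funext n; simp [Equiv.subLeft_apply]
    rw [this]; exact (Equiv.summable_iff _).2 hg₁sum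
  have hgsum : Summable g := hg₁sum.add hg₁shift
  have htg₁shift : ∑' n : ℤ, g₁ (t - n) = ∑' n : ℤ, g₁ n := by
    have : (fun n : ℤ => g₁ (t - n)) = g₁ ∘ (Equiv.subLeft t) := by funext n; simp [Equiv.subLeft_apply]
    rw [this]; exact Equiv.tsum_eq _ _
  -- `Σ_{n∈ℤ} g₁ n = Σ_{k∈ℕ} g₁ k + Σ_{k∈ℕ} g₁ (−(k+1))`, each `= Σ_j 2/ω_{j+M}² ≤ β/ω_M`
  have hnat : ∀ k : ℕ, g₁ (k : ℤ) = if k < M then 0 else 2 / ppFreq β k ^ 2 := fun k => by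
    simp only [hg₁, hinW, ppFreqZ_natCast]
    by_cases hk : k < M
    · rw [if_pos ⟨by omega, by exact_mod_cast hk⟩, if_pos hk]
    · rw [if_neg (fun h => hk (by exact_mod_cast h.2)), if_neg hk]
  have hneg : ∀ k : ℕ, g₁ (-((k : ℤ) + 1)) = if k < M then 0 else 2 / ppFreq β k ^ 2 := fun k => by
    simp only [hg₁, hinW, ppFreqZ_neg_succ, neg_sq]
    by_cases hk : k < M
    · rw [if_pos ⟨by omega, by omega⟩, if_pos hk]
    · rw [if_neg (fun h => hk (by omega)), if_neg hk]
  set G : ℕ → ℝ := fun k => if k < M then 0 else 2 / ppFreq β k ^ 2 with hG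
  have hGbd : ∀ j, |G (j + M)| ≤ 2 * (1 / (ppFreq β (j + M) ^ 2 + 0 ^ 2)) := fun j => by
    have hω := ppFreq_pos hβ (j + M)
    simp only [hG, show ¬(j + M < M) by omega, if_false]
    rw [abs_of_pos (by positivity), zero_pow two_ne_zero, add_zero, mul_one_div]
  have hGsum' : Summable fun j => G (j + M) := Summable.of_norm_bounded (((summable_nat_add_iff M).2 (summable_one_div_ppFreq_sq_add_sq hβ 0)).mul_left 2)
    fun j => by rw [Real.norm_eq_abs]; exact hGbd j
  have hGsum : Summable G := (summable_nat_add_iff M).1 hGsum'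
  have hGhead : ∑ k ∈ Finset.range M, G k = 0 := Finset.sum_eq_zero fun k hk => by simp only [hG, Finset.mem_range.1 hk, if_true]
  have hGtsum : ∑' k : ℕ, G k ≤ β / ppFreq β M := by
    rw [← hGsum.sum_add_tsum_nat_add M, hGhead, zero_add]
    have h := abs_tsum_shift_le_of_inv_sq hβ (by norm_num : (0 : ℝ) ≤ 2) M hGbd
    calc ∑' j : ℕ, G (j + M) ≤ |∑' j : ℕ, G (j + M)| := le_abs_self _
      _ ≤ 2 * (β / (2 * ppFreq β M)) := h
      _ = β / ppFreq β M := by field_simp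
  have h1s : Summable fun k : ℕ => g₁ (k : ℤ) := by simp_rw [hnat]; exact hGsum
  have h2s : Summable fun k : ℕ => g₁ (-((k : ℤ) + 1)) := by simp_rw [hneg]; exact hGsum
  have htg₁ : ∑' n : ℤ, g₁ n ≤ 2 * (β / ppFreq β M) := by
    rw [tsum_of_nat_of_neg_add_one h1s h2s]
    simp_rw [hnat, hneg]
    linarith
  have htg : ∑' n : ℤ, g n ≤ 4 * (β / ppFreq β M) := by
    rw [hg, hg₁sum.tsum_add hg₁shift, htg₁shift]; linarith
  -- (5) assemble
  have hnb : ‖∑' n : ℤ, b n‖ ≤ 4 * (β / ppFreq β M) :=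
    (norm_tsum_le_tsum_norm hbsum.norm).trans ((Summable.tsum_le_tsum hbg hbsum.norm hgsum).trans htg)
  rw [hdiff, norm_mul]
  have hβn : ‖((1 / β : ℝ) : ℂ)‖ = 1 / β := by rw [Complex.norm_real, Real.norm_eq_abs, abs_of_pos (by positivity)]
  rw [hβn]
  calc 1 / β * ‖∑' n : ℤ, b n‖ ≤ 1 / β * (4 * (β / ppFreq β M)) := mul_le_mul_of_nonneg_left hnb (by positivity)
    _ = 4 / ppFreq β M := by field_simp

/-- The windowed pair sum scales with the volume constant: `W_c = c²·W₁`. [cite: Salmhofer1999, §4.2.5 (4.70)] -/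
theorem ppTransferWindowSum_eq_sq_mul (β Λ c : ℝ) (M : ℕ) (t : ℤ) (e u : ℝ) :
    ppTransferWindowSum β Λ c M t e u = (c : ℂ) ^ 2 * ppTransferWindowSum β Λ 1 M t e u := by
  have hscale : ∀ x ω : ℝ, uvSymbolFn c Λ x ω = (c : ℂ) * uvSymbolFn 1 Λ x ω := fun x ω => by
    unfold uvSymbolFn resolventFn; push_cast; ring
  unfold ppTransferWindowSum
  rw [Finset.mul_sum]
  refine Finset.sum_congr rfl fun i _ => ?_
  split_ifs
  · rw [hscale e, hscale u]; ring
  · simp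

/-- The integer criterion for the transfer hypothesis: `4|t+1| + 0 ≤ 2M + 1 ⟹ 2|Ω| ≤ ω_M`. [folklore] -/
theorem two_abs_ppBose_le_ppFreq {β : ℝ} (hβ : 0 < β) {M : ℕ} {t : ℤ} (h : 4 * |t + 1| ≤ 2 * (M : ℤ) + 1) :
    2 * |ppBose β (t + 1)| ≤ ppFreq β M := by
  have h' : 4 * |((t + 1 : ℤ) : ℝ)| ≤ 2 * (M : ℝ) + 1 := by
    rw [← Int.cast_abs]; exact_mod_cast h
  unfold ppBose ppFreq
  rw [abs_div, abs_of_pos hβ, ← mul_div_assoc, div_le_div_iff_of_pos_right hβ, abs_mul, abs_mul, abs_of_pos Real.pi_pos,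
    abs_of_pos (by norm_num : (0 : ℝ) < 2)]
  push_cast at h' ⊢
  nlinarith [Real.pi_pos, abs_nonneg ((t : ℝ) + 1), mul_le_mul_of_nonneg_right h' Real.pi_pos.le]

/-- **THE MODEL'S pp BUBBLE AT EVERY SLICE FREQUENCY, IN TERMS OF `K_Ω`**: combining `secondOrder_ppBubble_transfer_eq`, `ppTransferWindowSum_eq_sq_mul` and
`norm_ppTransferKernel_sub_window_le`: per lattice momentum the constrained pair sum is `β(βL²)²·K_Ω(e_K p⃗, e_K(S⃗−p⃗))` up to `(βL²)²·β·4/ω_M` (count-free).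
[cite: BenfattoGiulianiMastropietro2006, §2.1 (2.3)-(2.4)] -/
theorem norm_ppTransferWindowSum_sub_kernel_le {β Λ : ℝ} (hβ : 0 < β) (hΛ : 0 < Λ) (c : ℝ) {M : ℕ} {t : ℤ} (hΩ : 2 * |ppBose β (t + 1)| ≤ ppFreq β M)
    (e u : ℝ) :
    ‖ppTransferWindowSum β Λ c M t e u - (c : ℂ) ^ 2 * (β : ℂ) * ppTransferKernel β Λ (t + 1) e u‖ ≤ c ^ 2 * β * (4 / ppFreq β M) := by
  have h := norm_ppTransferKernel_sub_window_le hβ hΛ hΩ e u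
  have hβ0 : (β : ℂ) ≠ 0 := by exact_mod_cast hβ.ne'
  have hid : ppTransferWindowSum β Λ c M t e u - (c : ℂ) ^ 2 * (β : ℂ) * ppTransferKernel β Λ (t + 1) e u =
      -((c : ℂ) ^ 2 * (β : ℂ)) * (ppTransferKernel β Λ (t + 1) e u - ((1 / β : ℝ) : ℂ) * ppTransferWindowSum β Λ 1 M t e u) := by
    rw [ppTransferWindowSum_eq_sq_mul]; push_cast; field_simp; ring
  rw [hid, norm_mul, norm_neg, norm_mul, norm_pow, Complex.norm_real, Complex.norm_real, Real.norm_eq_abs, Real.norm_eq_abs, abs_of_pos hβ, sq_abs]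
  exact mul_le_mul_of_nonneg_left h (by positivity)

end TransferTail

/-! ## §12 The ph bubble at EVERY transfer: `S_ph(d) = −Σ_{p⃗} W^{pp}_{−d−1}(e_K p⃗, −e_K(p⃗+q⃗−k⃗))` -/

section TransferPh

open Literature.Probability.LatticeModels

variable {L : ℕ}

/-- **Constrained pair sum at ph transfer label `d`** (`n_p + a = n_{p′} + b`, `d = a − b`; `p⃗ + q⃗ = p⃗′ + k⃗`): the partner of the line `p` has label `n_p + d`
(window indicator) and momentum `p⃗ + q⃗ − k⃗`. [folklore] -/
theorem sum_sum_ite_ph_transfer_eq {M : ℕ} [NeZero L] (β : ℝ) (a b : ℤ) (f : FreqMomentum L M → ℂ) (g : ℝ → TorusSite 2 L → ℂ) (k q : TorusSite 2 L) :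
    ∑ p : FreqMomentum L M, ∑ p' : FreqMomentum L M,
        (if matsubaraInt M p.1 + a = matsubaraInt M p'.1 + b ∧ p.2 + q = p'.2 + k then f p * g (matsubaraFreq β M p'.1) p'.2 else 0) =
      ∑ p : FreqMomentum L M, if -(M : ℤ) ≤ matsubaraInt M p.1 + (a - b) ∧ matsubaraInt M p.1 + (a - b) < M then
        f p * g (ppFreqZ β (matsubaraInt M p.1 + (a - b))) (p.2 + q - k) else 0 := by
  classical
  refine Finset.sum_congr rfl fun p _ => ?_
  rw [Fintype.sum_prod_type]
  have hinner : ∀ i' : MatsubaraIdx M, ∑ v' : TorusSite 2 L,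
      (if matsubaraInt M p.1 + a = matsubaraInt M i' + b ∧ p.2 + q = v' + k then f p * g (matsubaraFreq β M i') v' else 0) =
        if matsubaraInt M i' = matsubaraInt M p.1 + (a - b) then f p * g (ppFreqZ β (matsubaraInt M p.1 + (a - b))) (p.2 + q - k) else 0 := by
    intro i'
    by_cases hi : matsubaraInt M i' = matsubaraInt M p.1 + (a - b)
    · rw [if_pos hi]
      have hsum : matsubaraInt M p.1 + a = matsubaraInt M i' + b := by omega
      have hcond : ∀ v' : TorusSite 2 L, (matsubaraInt M p.1 + a = matsubaraInt M i' + b ∧ p.2 + q = v' + k) ↔ p.2 + q - k = v' := by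
        intro v'
        constructor
        · rintro ⟨_, h2⟩; rw [h2]; abel
        · intro h; refine ⟨hsum, ?_⟩; rw [← h]; abel
      simp_rw [hcond, Finset.sum_ite_eq, Finset.mem_univ, if_true, matsubaraFreq_eq_ppFreqZ, hi]
    · rw [if_neg hi]
      refine Finset.sum_eq_zero fun v' _ => ?_
      rw [if_neg]
      rintro ⟨h1, _⟩
      exact hi (by omega)
  simp_rw [hinner]
  exact sum_ite_matsubaraInt_eq (matsubaraInt M p.1 + (a - b)) _

/-- The ph partner's frequency through the pp window variables: `ω_{n+d} = −(ppBose β (−d−1+1) − ωₙ)`, i.e. `ωₙ + D = −((−D) − ωₙ)`. [folklore] -/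
theorem ppFreqZ_add_eq_neg (β : ℝ) (n d : ℤ) : ppFreqZ β (n + d) = -(ppBose β (-d - 1 + 1) - ppFreqZ β n) := by
  unfold ppFreqZ ppBose; push_cast; ring

/-- **THE ph BUBBLE OF THE SECOND-ORDER TADPOLE VERTEX AT EVERY SLICE FREQUENCY**: with ph transfer label `d = n_{p₀} − n_κ` (from the constraint
`n_p + n_{p₀} = n_{p′} + n_κ`), the constrained double sum of `Ψ_n(p)Ψ_n(p′)` is MINUS the lattice-momentum sum of the pp WINDOWED pair sum at transfer label
`−d−1` and NEGATED partner level: `S_ph(d) = −Σ_{p⃗} ppTransferWindowSum β Λ (βL²) M (−d−1) (e_K p⃗) (−e_K(p⃗+q⃗−k⃗))` (`Ψ_c(u, ω+D) = −Ψ_c(−u, (−D)−ω)`;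
at `d = 0` this is part 3's `secondOrder_phBubble_zeroTransfer_eq`). [cite: BenfattoGiulianiMastropietro2006, §2.1 (2.3)-(2.4)] -/
theorem secondOrder_phBubble_transfer_eq {M : ℕ} [NeZero L] {β : ℝ} (hβ : 0 < β) (μ : ℝ) (K : TrigPolyC4v) (Λ : ℝ) (a b : ℤ) (k q : TorusSite 2 L) :
    ∑ p : FreqMomentum L M, ∑ p' : FreqMomentum L M,
        (if matsubaraInt M p.1 + a = matsubaraInt M p'.1 + b ∧ p.2 + q = p'.2 + k then
          uvSymbolCT L M β μ K Λ (p, 0) * uvSymbolCT L M β μ K Λ (p', 0) else 0) =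
      -∑ pv : TorusSite 2 L, ppTransferWindowSum β Λ (β * (L : ℝ) ^ 2) M (-(a - b) - 1) (nambuXiCT L μ K pv) (-nambuXiCT L μ K (pv + q - k)) := by
  classical
  have hΨ : ∀ p' : FreqMomentum L M, uvSymbolCT L M β μ K Λ (p', 0) = uvSymbolFn (β * (L : ℝ) ^ 2) Λ (nambuXiCT L μ K p'.2) (matsubaraFreq β M p'.1) :=
    fun p' => uvSymbolCT_eq_uvSymbolFn hβ μ K Λ p'.1 p'.2 0
  simp_rw [hΨ]
  rw [sum_sum_ite_ph_transfer_eq β a b (fun p => uvSymbolFn (β * (L : ℝ) ^ 2) Λ (nambuXiCT L μ K p.2) (matsubaraFreq β M p.1))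
    (fun ω v => uvSymbolFn (β * (L : ℝ) ^ 2) Λ (nambuXiCT L μ K v) ω) k q, Fintype.sum_prod_type, Finset.sum_comm, ← Finset.sum_neg_distrib]
  refine Finset.sum_congr rfl fun pv _ => ?_
  unfold ppTransferWindowSum
  rw [← Finset.sum_neg_distrib]
  refine Finset.sum_congr rfl fun i _ => ?_
  have hwin : (-(M : ℤ) ≤ matsubaraInt M i + (a - b) ∧ matsubaraInt M i + (a - b) < M) ↔
      (-(M : ℤ) ≤ -(a - b) - 1 - matsubaraInt M i ∧ -(a - b) - 1 - matsubaraInt M i < M) := by omega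
  by_cases h : -(M : ℤ) ≤ matsubaraInt M i + (a - b) ∧ matsubaraInt M i + (a - b) < M
  · rw [if_pos h, if_pos (hwin.1 h), ppFreqZ_add_eq_neg, ← matsubaraFreq_eq_ppFreqZ]
    -- `Ψ_c(u, ω) = −Ψ_c(−u, −ω)` (weight even in both variables, resolvent odd; = `uvSymbolFn_neg_neg` of part 3)
    have hneg : ∀ c' Λ' x ω : ℝ, uvSymbolFn c' Λ' x ω = -uvSymbolFn c' Λ' (-x) (-ω) := by
      intro c' Λ' x ω
      unfold uvSymbolFn resolventFn uvWeightFn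
      have h : (-I * (((-ω) + 0 : ℝ) : ℂ) + ((-x : ℝ) : ℂ)) = -(-I * ((ω + 0 : ℝ) : ℂ) + (x : ℂ)) := by push_cast; ring
      rw [h, div_neg, neg_sq, neg_sq, mul_neg, neg_neg]
    rw [hneg (β * (L : ℝ) ^ 2) Λ (nambuXiCT L μ K (pv + q - k)) (-(ppBose β (-(a - b) - 1 + 1) - matsubaraFreq β M i)), neg_neg]
    ring
  · rw [if_neg h, if_neg (fun h' => h (hwin.2 h')), neg_zero]

end TransferPh

end Summit.HubbardSuperconductivity.HubbardSuperconductivity.Theorems.C4a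

end
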